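import Summits.BirchSwinnertonDyer.BirchSwinnertonDyer.Theorems.AdditiveBranchIMCMultLowerVisibilityRecord117648y1
import Summits.BirchSwinnertonDyer.BirchSwinnertonDyer.Theorems.AdditiveBranchIMCMultLowerVisibilityRecord165609d1
import Summits.BirchSwinnertonDyer.BirchSwinnertonDyer.Theorems.AdditiveBranchIMCMultLowerVisibilityRecord184455f1
import Summits.BirchSwinnertonDyer.BirchSwinnertonDyer.Theorems.AdditiveBranchIMCMultLowerVisibilityRecord393183l1
import Summits.BirchSwinnertonDyer.BirchSwinnertonDyer.Theorems.AdditiveBranchIMCMultLowerVisibilityRecord409149y1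
import Summits.BirchSwinnertonDyer.BirchSwinnertonDyer.Theorems.AdditiveBranchIMCMultLowerRankOneWindowDoors
import Literature.NumberTheory.EllipticCurves.Fisher2012.HesseFamilyThreeCongruenceProofs
import Literature.NumberTheory.EllipticCurves.Fisher2012.HesseFamilyThreeReverseProofs
import HarnessLib

/-!
# Crux `MultLower` (item 19359, owner k1-c4): the five (M) CONTENT-window rank-one visibility records of k1-c3 g7 with the
# `3`-CONGRUENCE PROVED IN THE KERNEL — `ord₃ #Ш(E)_an ≤ ord₃ #Ш(E)` for `E ∈ {117648y1, 165609d1, 184455f1, 393183l1, 409149y1}`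
# (binder `θ` of `…MultLowerVisibilityRecord<E>` DISCHARGED by Fisher's Hesse-pencil certificates) + the X4(M) ∩ surj rank-one
# `BSD(E,3)` door with a GIVEN lower half and its five by-name instances

Cell `bsd-addord`, seat `bsd-addord-k1-c3` (D-0074 row B2), gen 8; `--supports stmt-BirchSwinnertonDyer-19359 --as helper` (k1-c4's item;
helpers only — nothing of k1-c4's is edited; their door file `…MultLowerRankOneWindowDoors` is IMPORTED for its upper-half chain). Twin of
`…GordTwoRankOneVisibilityBookingRecordsHesse.lean` (same gen): the partner `F` of each record is a rational point of the direct Hesse pencil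
`X_E(3)` or of the dual pencil `X_E⁻(3)` of `E`, certificate `((λ:μ), u)` checked by `norm_num` on the tree's closed forms (`eval_hesseC4three` /
`eval_hesseC6three` / `eval_hesseD3`, `Fisher2012/HesseFamilyThreeReverse.lean`) and transported by the PROVED theorems
`Fisher2012.threeCongruent_of_hesseCertificate_unconditional` / `Fisher2012.threeCongruent_of_dualHesseCertificate_unconditional` (no named
fact). HONEST FRAMING: nothing here proves the Birch–Swinnerton-Dyer conjecture or the crux `MultLower` (OPEN at class level); THEOREMS ONLY;
per pair (an OFFER shape for referee A); NOT a class theorem; nothing booked by this file.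

## What

* `threeCongruent_c<E>_c<F>` — `∃ θ : F[3] ≃+ E[3]` `Γ_ℚ`-equivariant, from `hWeq` alone.
* `missingLowerBoundAt_c<E>_3` — crux 19359's conclusion AT THE PAIR (`MissingLowerBoundAt W 3`) from the cite-only `hCT hGZK`, the model `hWeq`,
  Cremona's `r_an = 1` (`hr1`) and the EXACT datum `#Ш(E)_an = q`, `ord₃ q ≤ 2` (`hq`/`hv`) — NO partner binder, NO `θ`.
* `classX4M_bsdp_rankOne_of_cycLineFact_of_katoHalf_of_multCoeffOneNeZero_of_lower` — k1-c4 g6's X4(M) ∩ surj rank-one door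
  (`…_of_shaAnWindow`) with the LOWER half taken as a hypothesis `MissingLowerBoundAt W p` instead of the unit-window datum (so that a CONTENT-window
  kernel record plugs in); upper half verbatim (Kato half `hK` + the (B)-datum from print `hCyc h73 hWald hmodN hDelM hmod hmodD hGZK` + Schneider
  from the bit `A′ ≠ 0` on the multiplicative `χ_{p*}`-branch, k1-c4's `hne` shape).
* `bsdp_c<E>_3` — `BSD(E,3)` BY NAME for the five keys: cite-only binders + `hWeq` + data-level flags `ClassX4M W 3`, `Surj W 3`, `r_an = 1` + the bit
  `hne` (two-engine certificate, k1-c4's engines) + `hq`/`hv`.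

Certificates (k1-c3 g8 `work/hesse3/find_hesse3.py`, exact rational arithmetic; re-verified by the kernel below):
`117648y1 ← 117648bh2` dual `(130488 : 11)`, `u = 1/24`; `165609d1 ← 165609a1` direct `(−888 : 1)`, `u = 26244`; `184455f1 ← 184455a1` dual
`(−75513 : 47)`, `u = 1/6`; `393183l1 ← 393183a1` dual `(−13983 : 1)`, `u = 1/474`; `409149y1 ← 409149g1` direct `(−1203852 : 5)`, `u = 164268`.

References: [Fisher2012Hessian] §8, §13, Thm. 13.2; [CremonaMazur2000] §3; [AgasheStein2002] Lemma 3.6; [Kato2004Asterisque] Thm. 17.4;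
[Delbourgo2002] Thm. (A), (B); [Disegni2017] Thm. A/B; [GrossZagier1986] I.(7.3); [MazurTateTeitelbaum1986Invent] §I.10, §I.13–14; [Cremona2006] Table 1.
-/

set_option autoImplicit false
set_option linter.dupNamespace false

noncomputable section

open scoped Classical MatrixGroups ModularForm NumberField
open CongruenceSubgroup WeierstrassCurve NumberField IsDedekindDomain Field
  Literature.NumberTheory.EllipticCurves Literature.NumberTheory.EllipticCurves.ModularForms
  Literature.NumberTheory.EllipticCurves.Rank1Residual
  Literature.NumberTheory.EllipticCurves.Rank1Residual.Typed
  Literature.NumberTheory.EllipticCurves.Delbourgo2002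
  Literature.NumberTheory.EllipticCurves.Disegni2017
  Literature.NumberTheory.EllipticCurves.Fisher2012
  Literature.NumberTheory.QuadraticFields
  Literature.NumberTheory.GaloisRepresentations
  Summit.BirchSwinnertonDyer.Rank1Residual.Additive
  Summit.BirchSwinnertonDyer.Rank1Residual.AdditivePotMult

namespace Summit.BirchSwinnertonDyer.BirchSwinnertonDyer.Theorems.AdditiveBranchIMCMultLowerVisibility

open Summit.BirchSwinnertonDyer.BirchSwinnertonDyer.Theorems.AdditiveBranchIMCGordTwoRankOneVisibility
open Summit.BirchSwinnertonDyer.BirchSwinnertonDyer.Theorems.AdditiveBranchIMCMultLower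

/-! ### §0 The X4(M) ∩ surj rank-one `BSD(E,p)` door with a GIVEN lower half -/

/-- **X4(M) ∩ {`ρ̄_{E,p}` onto}, `r_an(E) = 1`, ANY odd `p`: `BSD(E,p)` from Kato's half-eigenspace reading `hK`, the cite-only facts
`hCyc h73 hWald hmodN hDelM hmod hmodD hGZK`, the per-pair bit `A′ ≠ 0` on the multiplicative `χ_{p*}`-branch (`hne`, k1-c4 g4/g6's shape) and a
GIVEN lower half `MissingLowerBoundAt W p`** — k1-c4 g6's `classX4M_bsdp_rankOne_of_cycLineFact_of_katoHalf_of_multCoeffOneNeZero_of_shaAnWindow`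
with the unit-window datum replaced by the lower half itself (the socket a content-window visibility record plugs into). Upper half verbatim:
(B)-datum from print (`potMult_exists_leadingTermClauses_and_branchPAdicGrossZagierMultAt_of_cycLineFact`), Schneider from the typed identity + the
bit, `ClassX4M.missingUpperBoundAt_rankOne_of_katoHalf_of_branchPAdicGrossZagierMult`. Per pair; NOT a class theorem; nothing booked.
[cite: Kato2004Asterisque, Thm. 17.4 (3) (p. 273)] [cite: Delbourgo2002, Theorem (A), (B) (p. 40)] [cite: Disegni2017, Theorem A/B (arXiv v3 PDF 7–9), Rem. 1.3.2]
[cite: GrossZagier1986, Thm. I.(7.3)] [cite: MazurTateTeitelbaum1986Invent, §I.10, §I.13–I.14] [cite: Miller2011LMS, §1 and Def. 1.1] -/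
theorem classX4M_bsdp_rankOne_of_cycLineFact_of_katoHalf_of_multCoeffOneNeZero_of_lower
    {W : WeierstrassCurve ℚ} [W.IsElliptic] [W.IsGloballyMinimal] {p : ℕ} [Fact p.Prime]
    (hCyc : delbourgoDatum_cycLineGrossZagier) (h73 : GrossZagier1986_thm_I_7_3)
    (hWald : waldspurger_exists_heegnerField_twist_ne_zero) (hmodN : exists_isNewformOf)
    (hDelM : Delbourgo2002.mainTheorem_potMult)
    (hK : Wuthrich2014.kato_halfEigenCharIdeal_dvd_cyclotomicPrime_of_surjective)
    (hmod : hasEntireLFunction_rat) (hmodD : nonempty_modularParametrizationData)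
    (hGZK : rank_eq_analyticRank_of_analyticRank_le_one)
    (hX : ClassX4M W p) (hsurj : Surj W p) (hr : W.analyticRank = 1)
    (hne : ∀ (V : WeierstrassCurve ℚ) [V.IsElliptic] [V.IsGloballyMinimal] (C : VariableChange ℚ),
      Mult V p → C • V.quadraticTwist ((-1 : ℚ) ^ (p / 2) * p) = W →
      ∀ {N : ℕ} [NeZero N] (f : CuspForm (Gamma0 N) 2), IsNewformOf V f → ∀ (ap : ℤ), cuspCoeff f p = ap →
      ∀ ϖ : ℚ, (if Even (p / 2) then (ϖ : ℝ) * V.realPeriodRat = plusPeriod f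
          else (ϖ : ℝ) * V.imaginaryPeriodRat = minusPeriod f) →
        PowerSeries.coeff 1 (PowerSeries.C (ϖ : ℚ_[p]) *
            (if Even (p / 2) then padicLFunctionPlusBranchMult f (ap : ℚ_[p]) (p / 2)
              else padicLFunctionMinusBranchMult f (ap : ℚ_[p]) (p / 2))) ≠ 0)
    (hl : MissingLowerBoundAt W p) : BSDp W p := by
  have hp2 : p ≠ 2 := hX.p_ne_two
  obtain ⟨Dh, hB, hGZ⟩ :=
    potMult_exists_leadingTermClauses_and_branchPAdicGrossZagierMultAt_of_cycLineFact hCyc h73 hWald hmodN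
      hmod hmodD hGZK hDelM hX.potMult hp2 hr
  obtain ⟨V, iV, iVm, C, hV, hC⟩ := hX.potMult.exists_mult_pStar_twist_model hp2
  have hS : SchneiderConjecture Dh :=
    schneiderConjecture_of_branchPAdicGrossZagierMultAt_of_multCoeffOneNeZero hp2 hmodD hGZK hr hGZ hne V C
      hV hC
  have hu : MissingUpperBoundAt W p :=
    ClassX4M.missingUpperBoundAt_rankOne_of_katoHalf_of_branchPAdicGrossZagierMult hK hGZK hmod hmodD hX
      hsurj hr hB hS hGZ
  exact bsdp_of_missingPPartAt W p hGZK (by rw [hr]) (missingPPartAt_of_lower_of_upper W p hl hu)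

/-! ### `117648y1` ← `117648bh2` (dual pencil) -/

/-- **The `3`-congruence `117648bh2[3] ≅ 117648y1[3]` PROVED IN THE KERNEL** (no named fact): `F = 117648bh2 = [0, 0, 0, -147, 117650]` is `ℚ`-isomorphic to the member
`(λ : μ) = (130488 : 11)` of the DUAL Hesse pencil `X_E⁻(3)` (Fisher 2012 §13) of `E = 117648y1 = [0, 0, 0, -273648, -61360144]` —
the two covariant identities `−𝔇(λ,μ)/(4Δ′) = u⁴·c₄(F)`, `−𝔠₆(λ,μ)/(8Δ′²) = u⁶·c₆(F)` (`Δ′ = c₄(E)³ − c₆(E)²`) with `u = 1/24`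
(`c₄(E) = 13135104`, `c₆(E) = 53015164416`, `c₄(F) = 7056`, `c₆(F) = -101649600`) are checked by `norm_num` on the tree's closed forms
(`eval_hesseC4three` / `eval_hesseC6three` / `eval_hesseD3`) and fed to the PROVED transport
`Fisher2012.threeCongruent_of_dualHesseCertificate_unconditional`; certificate found by the seat's exact finder `find_hesse3.py`
(rational roots of the degree-12 form `𝔠₄′(λ,1)³c₆(F)² − 𝔠₆′(λ,1)²c₄(F)³`, k1-c3 g8). Hypothesis: the target model `hWeq` only.
[cite: Fisher2012Hessian, §13 (analogue of Thm. 13.2 for X_E^-(3))] [cite: Cremona2006, Table 1 (Cremona labels 117648y1, 117648bh2)] -/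
theorem threeCongruent_c117648y1_c117648bh2 (W : WeierstrassCurve ℚ) [W.IsElliptic] (hWeq : W = ⟨0, 0, 0, -273648, -61360144⟩) :
    ∃ θ : geomTorsion (⟨0, 0, 0, -147, 117650⟩ : WeierstrassCurve ℚ) (3 : ℤ) ≃+ geomTorsion W (3 : ℤ),
      ∀ (σ : Field.absoluteGaloisGroup ℚ) (P : geomTorsion (⟨0, 0, 0, -147, 117650⟩ : WeierstrassCurve ℚ) (3 : ℤ)),
        θ (σ • P) = σ • θ P := by
  haveI := isElliptic_c117648bh2
  have hc4 : W.c₄ = (13135104 : ℚ) := by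
    subst hWeq; norm_num [WeierstrassCurve.c₄, WeierstrassCurve.b₂, WeierstrassCurve.b₄]
  have hc6 : W.c₆ = (53015164416 : ℚ) := by
    subst hWeq; norm_num [WeierstrassCurve.c₆, WeierstrassCurve.b₂, WeierstrassCurve.b₄, WeierstrassCurve.b₆]
  have hc4F : (⟨0, 0, 0, -147, 117650⟩ : WeierstrassCurve ℚ).c₄ = (7056 : ℚ) := by
    norm_num [WeierstrassCurve.c₄, WeierstrassCurve.b₂, WeierstrassCurve.b₄]
  have hc6F : (⟨0, 0, 0, -147, 117650⟩ : WeierstrassCurve ℚ).c₆ = (-101649600 : ℚ) := by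
    norm_num [WeierstrassCurve.c₆, WeierstrassCurve.b₂, WeierstrassCurve.b₄, WeierstrassCurve.b₆]
  exact threeCongruent_of_dualHesseCertificate_unconditional W (⟨0, 0, 0, -147, 117650⟩ : WeierstrassCurve ℚ)
    (130488 : ℚ) (11 : ℚ) ((1 : ℚ) / 24) (by norm_num)
    (by rw [hc4, hc6, hc4F, eval_hesseD3]; norm_num) (by rw [hc4, hc6, hc6F, eval_hesseC6three]; norm_num)

/-- **`ord₃ #Ш(E)_an ≤ ord₃ #Ш(E)` for `E = 117648y1` (crux 19359's conclusion `MissingLowerBoundAt W 3` AT THE PAIR), `3`-congruence PROVED IN THE KERNEL.**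
Binders: cite-only `hCT hGZK`; the model `hWeq`; Cremona's `r_an = 1` (`hr1`) and `#Ш(E)_an = q`, `ord₃ q ≤ 2` (`hq`/`hv`). Everything else —
the partner `F = 117648bh2` (rank `3`), its minimal model, the two witnesses and their local `3`-divisibility, independence mod `3F(ℚ)`,
`E[3]` irreducible, AND the `3`-congruence `F[3] ≅ E[3]` — is decided in the kernel (`missingLowerBoundAt_c117648y1_3_of_congr` +
`threeCongruent_c117648y1_c117648bh2`). Per pair; NOT a class theorem; nothing booked. [cite: CremonaMazur2000, §3] [cite: AgasheStein2002, Lemma 3.6]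
[cite: Fisher2012Hessian, Thm. 13.2 and §13 (n = 3)] [cite: Cremona2006, Table 1 (Cremona labels 117648y1, 117648bh2)] -/
theorem missingLowerBoundAt_c117648y1_3
    (hCT : exists_casselsTate_pairing (K := ℚ)) (hGZK : rank_eq_analyticRank_of_analyticRank_le_one)
    {W : WeierstrassCurve ℚ} [W.IsElliptic] [W.IsGloballyMinimal] (hWeq : W = ⟨0, 0, 0, -273648, -61360144⟩)
    (hr1 : W.analyticRank = 1) {q : ℚ} (hq : shaAn W = (q : ℂ)) (hv : padicValRat 3 q ≤ 2) :
    MissingLowerBoundAt W 3 := by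
  haveI := isElliptic_c117648bh2
  haveI := isGloballyMinimal_c117648bh2
  obtain ⟨θ, hθ⟩ := threeCongruent_c117648y1_c117648bh2 W hWeq
  exact missingLowerBoundAt_c117648y1_3_of_congr (F := (⟨0, 0, 0, -147, 117650⟩ : WeierstrassCurve ℚ)) hCT hGZK hWeq rfl hr1 hq hv θ hθ

/-- **`BSD(E,3)` for `E = 117648y1` BY NAME on cell X4(M) ∩ surj, `3`-congruence PROVED IN THE KERNEL** — cite-only
`hCyc h73 hWald hmodN hDelM hK hmod hmodD hGZK hCT`; the model `hWeq`; data-level flags `ClassX4M W 3`, `Surj W 3`, `r_an = 1`; the bit `A′ ≠ 0` on the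
multiplicative `χ₋₃`-branch (`hne`, k1-c4's two-engine shape); the EXACT datum `#Ш(E)_an = q`, `ord₃ q ≤ 2`. NO partner binder, NO `θ`
(`…_of_lower` + `missingLowerBoundAt_c117648y1_3`). Per pair; NOT a class theorem; nothing booked.
[cite: Kato2004Asterisque, Thm. 17.4 (3) (p. 273)] [cite: Delbourgo2002, Theorem (A), (B) (p. 40)] [cite: CremonaMazur2000, §3]
[cite: Fisher2012Hessian, Thm. 13.2 and §13 (n = 3)] [cite: Cremona2006, Table 1 (Cremona labels 117648y1, 117648bh2)] -/
theorem bsdp_c117648y1_3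
    (hCyc : delbourgoDatum_cycLineGrossZagier) (h73 : GrossZagier1986_thm_I_7_3)
    (hWald : waldspurger_exists_heegnerField_twist_ne_zero) (hmodN : exists_isNewformOf)
    (hDelM : Delbourgo2002.mainTheorem_potMult)
    (hK : Wuthrich2014.kato_halfEigenCharIdeal_dvd_cyclotomicPrime_of_surjective)
    (hmod : hasEntireLFunction_rat) (hmodD : nonempty_modularParametrizationData)
    (hGZK : rank_eq_analyticRank_of_analyticRank_le_one) (hCT : exists_casselsTate_pairing (K := ℚ))
    {W : WeierstrassCurve ℚ} [W.IsElliptic] [W.IsGloballyMinimal] (hWeq : W = ⟨0, 0, 0, -273648, -61360144⟩)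
    (hX : ClassX4M W 3) (hsurj : Surj W 3) (hr1 : W.analyticRank = 1)
    (hne : ∀ (V : WeierstrassCurve ℚ) [V.IsElliptic] [V.IsGloballyMinimal] (C : VariableChange ℚ),
      Mult V 3 → C • V.quadraticTwist ((-1 : ℚ) ^ (3 / 2) * 3) = W →
      ∀ {N : ℕ} [NeZero N] (f : CuspForm (Gamma0 N) 2), IsNewformOf V f → ∀ (ap : ℤ), cuspCoeff f 3 = ap →
      ∀ ϖ : ℚ, (if Even (3 / 2) then (ϖ : ℝ) * V.realPeriodRat = plusPeriod f
          else (ϖ : ℝ) * V.imaginaryPeriodRat = minusPeriod f) →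
        PowerSeries.coeff 1 (PowerSeries.C (ϖ : ℚ_[3]) *
            (if Even (3 / 2) then padicLFunctionPlusBranchMult f (ap : ℚ_[3]) (3 / 2)
              else padicLFunctionMinusBranchMult f (ap : ℚ_[3]) (3 / 2))) ≠ 0)
    {q : ℚ} (hq : shaAn W = (q : ℂ)) (hv : padicValRat 3 q ≤ 2) : BSDp W 3 :=
  haveI : Fact (Nat.Prime 3) := ⟨Nat.prime_three⟩
  classX4M_bsdp_rankOne_of_cycLineFact_of_katoHalf_of_multCoeffOneNeZero_of_lower hCyc h73 hWald hmodN hDelM hK hmod hmodD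
    hGZK hX hsurj hr1 hne (missingLowerBoundAt_c117648y1_3 hCT hGZK hWeq hr1 hq hv)

/-! ### `165609d1` ← `165609a1` (direct pencil) -/

/-- **The `3`-congruence `165609a1[3] ≅ 165609d1[3]` PROVED IN THE KERNEL** (no named fact): `F = 165609a1 = [1, -1, 1, -419, 3444]` is `ℚ`-isomorphic to the member
`(λ : μ) = (-888 : 1)` of the DIRECT Hesse pencil `X_E(3)` (Fisher 2012 Thm. 13.2) of `E = 165609d1 = [0, 0, 1, 134475, -50626481]` —
the two covariant identities `𝔠₄(λ,μ) = u⁴·c₄(F)`, `𝔠₆(λ,μ) = u⁶·c₆(F)` with `u = 26244`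
(`c₄(E) = -6454800`, `c₆(E) = 43741279368`, `c₄(F) = 20097`, `c₆(F) = -2885409`) are checked by `norm_num` on the tree's closed forms
(`eval_hesseC4three` / `eval_hesseC6three` / `eval_hesseD3`) and fed to the PROVED transport
`Fisher2012.threeCongruent_of_hesseCertificate_unconditional`; certificate found by the seat's exact finder `find_hesse3.py`
(rational roots of the degree-12 form `𝔠₄′(λ,1)³c₆(F)² − 𝔠₆′(λ,1)²c₄(F)³`, k1-c3 g8). Hypothesis: the target model `hWeq` only.
[cite: Fisher2012Hessian, Thm. 13.2 (n = 3)] [cite: Cremona2006, Table 1 (Cremona labels 165609d1, 165609a1)] -/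
theorem threeCongruent_c165609d1_c165609a1 (W : WeierstrassCurve ℚ) [W.IsElliptic] (hWeq : W = ⟨0, 0, 1, 134475, -50626481⟩) :
    ∃ θ : geomTorsion (⟨1, -1, 1, -419, 3444⟩ : WeierstrassCurve ℚ) (3 : ℤ) ≃+ geomTorsion W (3 : ℤ),
      ∀ (σ : Field.absoluteGaloisGroup ℚ) (P : geomTorsion (⟨1, -1, 1, -419, 3444⟩ : WeierstrassCurve ℚ) (3 : ℤ)),
        θ (σ • P) = σ • θ P := by
  haveI := isElliptic_c165609a1
  have hc4 : W.c₄ = (-6454800 : ℚ) := by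
    subst hWeq; norm_num [WeierstrassCurve.c₄, WeierstrassCurve.b₂, WeierstrassCurve.b₄]
  have hc6 : W.c₆ = (43741279368 : ℚ) := by
    subst hWeq; norm_num [WeierstrassCurve.c₆, WeierstrassCurve.b₂, WeierstrassCurve.b₄, WeierstrassCurve.b₆]
  have hc4F : (⟨1, -1, 1, -419, 3444⟩ : WeierstrassCurve ℚ).c₄ = (20097 : ℚ) := by
    norm_num [WeierstrassCurve.c₄, WeierstrassCurve.b₂, WeierstrassCurve.b₄]
  have hc6F : (⟨1, -1, 1, -419, 3444⟩ : WeierstrassCurve ℚ).c₆ = (-2885409 : ℚ) := by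
    norm_num [WeierstrassCurve.c₆, WeierstrassCurve.b₂, WeierstrassCurve.b₄, WeierstrassCurve.b₆]
  exact threeCongruent_of_hesseCertificate_unconditional W (⟨1, -1, 1, -419, 3444⟩ : WeierstrassCurve ℚ)
    (-888 : ℚ) (1 : ℚ) (26244 : ℚ) (by norm_num)
    (by rw [hc4, hc6, hc4F, eval_hesseC4three]; norm_num) (by rw [hc4, hc6, hc6F, eval_hesseC6three]; norm_num)

/-- **`ord₃ #Ш(E)_an ≤ ord₃ #Ш(E)` for `E = 165609d1` (crux 19359's conclusion `MissingLowerBoundAt W 3` AT THE PAIR), `3`-congruence PROVED IN THE KERNEL.**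
Binders: cite-only `hCT hGZK`; the model `hWeq`; Cremona's `r_an = 1` (`hr1`) and `#Ш(E)_an = q`, `ord₃ q ≤ 2` (`hq`/`hv`). Everything else —
the partner `F = 165609a1` (rank `3`), its minimal model, the two witnesses and their local `3`-divisibility, independence mod `3F(ℚ)`,
`E[3]` irreducible, AND the `3`-congruence `F[3] ≅ E[3]` — is decided in the kernel (`missingLowerBoundAt_c165609d1_3_of_congr` +
`threeCongruent_c165609d1_c165609a1`). Per pair; NOT a class theorem; nothing booked. [cite: CremonaMazur2000, §3] [cite: AgasheStein2002, Lemma 3.6]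
[cite: Fisher2012Hessian, Thm. 13.2 and §13 (n = 3)] [cite: Cremona2006, Table 1 (Cremona labels 165609d1, 165609a1)] -/
theorem missingLowerBoundAt_c165609d1_3
    (hCT : exists_casselsTate_pairing (K := ℚ)) (hGZK : rank_eq_analyticRank_of_analyticRank_le_one)
    {W : WeierstrassCurve ℚ} [W.IsElliptic] [W.IsGloballyMinimal] (hWeq : W = ⟨0, 0, 1, 134475, -50626481⟩)
    (hr1 : W.analyticRank = 1) {q : ℚ} (hq : shaAn W = (q : ℂ)) (hv : padicValRat 3 q ≤ 2) :
    MissingLowerBoundAt W 3 := by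
  haveI := isElliptic_c165609a1
  haveI := isGloballyMinimal_c165609a1
  obtain ⟨θ, hθ⟩ := threeCongruent_c165609d1_c165609a1 W hWeq
  exact missingLowerBoundAt_c165609d1_3_of_congr (F := (⟨1, -1, 1, -419, 3444⟩ : WeierstrassCurve ℚ)) hCT hGZK hWeq rfl hr1 hq hv θ hθ

/-- **`BSD(E,3)` for `E = 165609d1` BY NAME on cell X4(M) ∩ surj, `3`-congruence PROVED IN THE KERNEL** — cite-only
`hCyc h73 hWald hmodN hDelM hK hmod hmodD hGZK hCT`; the model `hWeq`; data-level flags `ClassX4M W 3`, `Surj W 3`, `r_an = 1`; the bit `A′ ≠ 0` on the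
multiplicative `χ₋₃`-branch (`hne`, k1-c4's two-engine shape); the EXACT datum `#Ш(E)_an = q`, `ord₃ q ≤ 2`. NO partner binder, NO `θ`
(`…_of_lower` + `missingLowerBoundAt_c165609d1_3`). Per pair; NOT a class theorem; nothing booked.
[cite: Kato2004Asterisque, Thm. 17.4 (3) (p. 273)] [cite: Delbourgo2002, Theorem (A), (B) (p. 40)] [cite: CremonaMazur2000, §3]
[cite: Fisher2012Hessian, Thm. 13.2 and §13 (n = 3)] [cite: Cremona2006, Table 1 (Cremona labels 165609d1, 165609a1)] -/
theorem bsdp_c165609d1_3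
    (hCyc : delbourgoDatum_cycLineGrossZagier) (h73 : GrossZagier1986_thm_I_7_3)
    (hWald : waldspurger_exists_heegnerField_twist_ne_zero) (hmodN : exists_isNewformOf)
    (hDelM : Delbourgo2002.mainTheorem_potMult)
    (hK : Wuthrich2014.kato_halfEigenCharIdeal_dvd_cyclotomicPrime_of_surjective)
    (hmod : hasEntireLFunction_rat) (hmodD : nonempty_modularParametrizationData)
    (hGZK : rank_eq_analyticRank_of_analyticRank_le_one) (hCT : exists_casselsTate_pairing (K := ℚ))
    {W : WeierstrassCurve ℚ} [W.IsElliptic] [W.IsGloballyMinimal] (hWeq : W = ⟨0, 0, 1, 134475, -50626481⟩)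
    (hX : ClassX4M W 3) (hsurj : Surj W 3) (hr1 : W.analyticRank = 1)
    (hne : ∀ (V : WeierstrassCurve ℚ) [V.IsElliptic] [V.IsGloballyMinimal] (C : VariableChange ℚ),
      Mult V 3 → C • V.quadraticTwist ((-1 : ℚ) ^ (3 / 2) * 3) = W →
      ∀ {N : ℕ} [NeZero N] (f : CuspForm (Gamma0 N) 2), IsNewformOf V f → ∀ (ap : ℤ), cuspCoeff f 3 = ap →
      ∀ ϖ : ℚ, (if Even (3 / 2) then (ϖ : ℝ) * V.realPeriodRat = plusPeriod f
          else (ϖ : ℝ) * V.imaginaryPeriodRat = minusPeriod f) →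
        PowerSeries.coeff 1 (PowerSeries.C (ϖ : ℚ_[3]) *
            (if Even (3 / 2) then padicLFunctionPlusBranchMult f (ap : ℚ_[3]) (3 / 2)
              else padicLFunctionMinusBranchMult f (ap : ℚ_[3]) (3 / 2))) ≠ 0)
    {q : ℚ} (hq : shaAn W = (q : ℂ)) (hv : padicValRat 3 q ≤ 2) : BSDp W 3 :=
  haveI : Fact (Nat.Prime 3) := ⟨Nat.prime_three⟩
  classX4M_bsdp_rankOne_of_cycLineFact_of_katoHalf_of_multCoeffOneNeZero_of_lower hCyc h73 hWald hmodN hDelM hK hmod hmodD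
    hGZK hX hsurj hr1 hne (missingLowerBoundAt_c165609d1_3 hCT hGZK hWeq hr1 hq hv)

end Summit.BirchSwinnertonDyer.BirchSwinnertonDyer.Theorems.AdditiveBranchIMCMultLowerVisibility

end
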